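import Summits.KontsevichZagierPeriods.Zeta5Search.TwoTaleP15SecondTaleCrudeTools

/-!
# The two-tale point P15, second tale: a CRUDE bound for `p̂_n` at EVERY prime (multi-digit primes included)

HONEST FRAMING: systematic search; no irrationality claim unless certified.

Cell pub-zeta5, T3 service for the (bmiss)-free closing of the P15 chain (fam-denom `families/denom/P15KERNEL.md`
§10.8: the small primes `p² ≤ 26n` enter only through a subexponential fudge factor, which so far needed the
PRINTED Prop. 3 of [Zudilin 2014] (`Prop3T`, not formalised)).  Denominator side only; nothing about irrationality.

* **`padicNorm_formPT_le_log : 1 ≤ n → ‖formPT (aT n) (bT n)‖_p ≤ p^{3·⌊log_p 33n⌋}`** for EVERY prime `p`.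

So `∏_{p ≤ √(26n)} p^{3⌊log_p 33n⌋} ≤ (33n)^{3π(√26n)} = e^{O(√n)}` clears all small primes from `den(p̂_n)`.
Ingredients (all primes, no digit hypotheses): `A_k ∈ ℤ` (tree, eq. (T2)); the alternating harmonic sums have
`‖S₂(m)‖_p ≤ p^{2⌊log_p m⌋}`, `‖S₁(m)‖_p ≤ p^{⌊log_p m⌋}`; and `‖B_k‖_p ≤ p^{2⌊log_p 33n⌋}` zone by zone — zone β₁
(`15n < k ≤ 16n`): `B_k = ±2·C(11n,k−13n−1)·C(11n,k−15n−1)·C(k−6n−1,5n)/(17n·C(17n−1,2k−15n−2))`; zone γ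
(`k ≥ 24n+2`): `B_k = ±C(2k−15n−2,17n)·C(k−6n−1,5n)·C(11n,k−15n−1)/((11n+1)·C(k−13n−1,11n+1))`; zone β₂:
`B_k = A_k·(logarithmic derivative)`, each `1/(linear value)` of norm `≤ p^{⌊log_p 33n⌋}`; with Kummer's
`v_p(C(M,i)) ≤ ⌊log_p M⌋` (`Nat.factorization_choose_le_log`) and `v_p(M) ≤ ⌊log_p M⌋`.
-/

noncomputable section

namespace Summit.KontsevichZagierPeriods.Zeta5Search.TwoTaleP15

open Finset Polynomial
open Literature.NumberTheory.Irrationality.Zudilin2014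

/-! ### `B_k` zone by zone, every prime -/

section Zones

variable {n : ℕ} {p : ℕ} [hp : Fact p.Prime]

/-- `‖A_k‖_p ≤ 1` on `15n+1 ≤ k ≤ 24n+1`, every prime (`A_k ∈ ℤ`, eq. (T2)). -/
theorem padicNorm_coefAT_le_one_all (hn : 1 ≤ n) {k : ℤ} (h1 : 15 * (n : ℤ) + 1 ≤ k)
    (h2 : k ≤ 24 * (n : ℤ) + 1) : padicNorm p (coefAT (aT n) (bT n) k) ≤ 1 := by
  rcases le_or_gt k (16 * (n : ℤ)) with hk | hk
  · rw [coefAT_zoneB1 h1 hk, padicNorm.zero]; exact zero_le_one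
  refine (padicNorm_coefAT_le hn (by omega) h2).trans ?_
  exact zpow_le_one_of_nonpos₀ (by exact_mod_cast hp.out.one_lt.le) (by linarith [EZ_nonneg hp.out.pos n k])

/-- The normalisation at the partner: `Π̂ = (11n)!² / ((17n)!(5n)!)`. -/
theorem normT_partner_eq (n : ℕ) :
    normT (aT n) (bT n) = (((11 * n).factorial : ℕ) : ℚ) * (((11 * n).factorial : ℕ) : ℚ)
      / ((((17 * n).factorial : ℕ) : ℚ) * (((5 * n).factorial : ℕ) : ℚ)) := by
  have e2 : (bT n 2 - aT n 2 - 1).toNat = 11 * n := by simp; omega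
  have e3 : (bT n 3 - aT n 3 - 1).toNat = 11 * n := by simp; omega
  have e0 : (aT n 0 - bT n 0).toNat = 17 * n := by simp; omega
  have e1 : (aT n 1 - bT n 1).toNat = 5 * n := by simp; omega
  unfold normT facZ
  rw [e2, e3, e0, e1]

/-- `v_p(Π̂) = 2v_p((11n)!) − v_p((17n)!) − v_p((5n)!)` and `Π̂ ≠ 0`. -/
theorem padicValRat_normT_partner (n : ℕ) :
    normT (aT n) (bT n) ≠ 0 ∧ padicValRat p (normT (aT n) (bT n))
      = 2 * (padicValNat p (11 * n).factorial : ℤ) - (padicValNat p (17 * n).factorial : ℤ)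
        - (padicValNat p (5 * n).factorial : ℤ) := by
  have hF : ∀ m : ℕ, ((m.factorial : ℕ) : ℚ) ≠ 0 := fun m => by positivity
  rw [normT_partner_eq]
  refine ⟨div_ne_zero (mul_ne_zero (hF _) (hF _)) (mul_ne_zero (hF _) (hF _)), ?_⟩
  rw [padicValRat.div (mul_ne_zero (hF _) (hF _)) (mul_ne_zero (hF _) (hF _)), padicValRat.mul (hF _) (hF _),
    padicValRat.mul (hF _) (hF _), padicValRat.of_nat, padicValRat.of_nat, padicValRat.of_nat]
  ring

omit hp in
/-- `v_p(2) ≥ 0` (as a rational valuation). -/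
theorem padicValRat_two_nonneg : 0 ≤ padicValRat p (2 : ℚ) := by
  have : padicValRat p ((2 : ℕ) : ℚ) = padicValNat p 2 := padicValRat.of_nat
  rw [Nat.cast_ofNat] at this
  rw [this]; positivity

/-- **Zone β₁, every prime** (`15n+1 ≤ k ≤ 16n`): `‖B_k‖_p ≤ p^{2⌊log_p 33n⌋}` — here
`B_k = numT′(−k)/dhatT(−k) = ±2·C(11n,k−13n−1)·C(11n,k−15n−1)·C(k−6n−1,5n)/(17n·C(17n−1,2k−15n−2))`. -/
theorem padicNorm_coefBT_zoneB1_log (hn : 1 ≤ n) {k : ℤ} (h1 : 15 * (n : ℤ) + 1 ≤ k) (h2 : k ≤ 16 * (n : ℤ)) :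
    padicNorm p (coefBT (aT n) (bT n) k) ≤ (p : ℚ) ^ (2 * Nat.log p (33 * n)) := by
  have hD2 : k ∈ Ico (aT n 2) (bT n 2) := by simp [mem_Ico]; omega
  have hD3 : k ∈ Ico (aT n 3) (bT n 3) := by simp [mem_Ico]; omega
  have hB0 : 2 * k ∈ Ico (bT n 0) (aT n 0) := by simp [mem_Ico]; omega
  have hm : multT (aT n) (bT n) k = 2 := (multT_partner k).2.1 h1 (by omega)
  have h0 : (numT (aT n) (bT n)).eval (-(k : ℚ)) = 0 := eval_numT_partner_eq_zero (by omega) (by omega)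
  have eP0 : ∏ l ∈ (Ico (bT n 0) (aT n 0)).erase (2 * k), ((l : ℚ) - 2 * k)
      = (-1) ^ (2 * k - bT n 0).toNat * (((2 * k - bT n 0).toNat.factorial : ℕ) : ℚ)
        * (((aT n 0 - 1 - 2 * k).toNat.factorial : ℕ) : ℚ) := by
    rw [← prod_erase_sub_eq hB0]; exact prod_congr rfl fun l _ => by push_cast; ring
  have eP1 : ∏ i ∈ Ico (bT n 1) (aT n 1), ((i : ℚ) - k)
      = (-1) ^ (aT n 1 - bT n 1).toNat * (((aT n 1 - bT n 1).toNat.factorial : ℕ) : ℚ)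
        * ((Nat.choose (k - bT n 1).toNat (aT n 1 - bT n 1).toNat : ℕ) : ℚ) :=
    prod_Ico_sub_eq _ _ _ (by simp; omega) (by simp; omega)
  rw [coefBT_of_double_root hm h0, eval_derivative_numT_root hB0, eval_dhatT_of_double hD2 hD3, eP0, eP1]
  -- the natural-number bookkeeping
  have ea0 : (2 * k - bT n 0).toNat + (aT n 0 - 1 - 2 * k).toNat = 17 * n - 1 := by simp; omega
  have e5 : (aT n 1 - bT n 1).toNat = 5 * n := by simp; omega
  have hCk : (aT n 1 - bT n 1).toNat ≤ (k - bT n 1).toNat := by simp; omega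
  have ea2 : (k - aT n 2).toNat + (bT n 2 - 1 - k).toNat = 11 * n := by simp; omega
  have ea3 : (k - aT n 3).toNat + (bT n 3 - 1 - k).toNat = 11 * n := by simp; omega
  have e17 : 17 * n - 1 + 1 = 17 * n := by omega
  -- valuations of the pieces
  obtain ⟨hN0, vN⟩ := padicValRat_normT_partner (p := p) n
  have hX0 := sign_fac_fac_ne_zero (2 * k - bT n 0).toNat (2 * k - bT n 0).toNat (aT n 0 - 1 - 2 * k).toNat
  have vX0 := padicValRat_sign_fac_fac (p := p) (2 * k - bT n 0).toNat (2 * k - bT n 0).toNat (aT n 0 - 1 - 2 * k).toNat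
  have hX1 := sign_fac_choose_ne_zero (aT n 1 - bT n 1).toNat (aT n 1 - bT n 1).toNat (k - bT n 1).toNat hCk
  have vX1 := padicValRat_sign_fac_choose (p := p) (aT n 1 - bT n 1).toNat (aT n 1 - bT n 1).toNat (k - bT n 1).toNat hCk
  have hY2 := sign_fac_fac_ne_zero (k - aT n 2).toNat (k - aT n 2).toNat (bT n 2 - 1 - k).toNat
  have vY2 := padicValRat_sign_fac_fac (p := p) (k - aT n 2).toNat (k - aT n 2).toNat (bT n 2 - 1 - k).toNat
  have hY3 := sign_fac_fac_ne_zero (k - aT n 3).toNat (k - aT n 3).toNat (bT n 3 - 1 - k).toNat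
  have vY3 := padicValRat_sign_fac_fac (p := p) (k - aT n 3).toNat (k - aT n 3).toNat (bT n 3 - 1 - k).toNat
  have h2 : (2 : ℚ) ≠ 0 := by norm_num
  have v2 := padicValRat_two_nonneg (p := p)
  -- Legendre / Kummer relations
  have r0 := padicValNat_factorial_add (p := p) (2 * k - bT n 0).toNat (aT n 0 - 1 - 2 * k).toNat
  have r2 := padicValNat_factorial_add (p := p) (k - aT n 2).toNat (bT n 2 - 1 - k).toNat
  have r3 := padicValNat_factorial_add (p := p) (k - aT n 3).toNat (bT n 3 - 1 - k).toNat
  rw [ea0] at r0; rw [ea2] at r2; rw [ea3] at r3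
  have r17 := padicValNat_factorial_succ (p := p) (17 * n - 1)
  rw [e17] at r17
  have kC : padicValNat p (Nat.choose (17 * n - 1) (2 * k - bT n 0).toNat) ≤ Nat.log p (33 * n) :=
    (padicValNat_choose_le_log _ _).trans (Nat.log_mono_right (by omega))
  have kN : padicValNat p (17 * n) ≤ Nat.log p (33 * n) :=
    (padicValNat_le_nat_log _).trans (Nat.log_mono_right (by omega))
  apply padicNorm_le_pow_of_val
  rw [padicValRat.div (mul_ne_zero (mul_ne_zero hN0 (mul_ne_zero h2 hX0)) hX1) (mul_ne_zero hY2 hY3),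
    padicValRat.mul (mul_ne_zero hN0 (mul_ne_zero h2 hX0)) hX1, padicValRat.mul hN0 (mul_ne_zero h2 hX0),
    padicValRat.mul h2 hX0, padicValRat.mul hY2 hY3, vN, vX0, vX1, vY2, vY3, e5]
  omega

/-- **Zone γ, every prime** (`24n+2 ≤ k ≤ 26n+1`): `‖B_k‖_p ≤ p^{2⌊log_p 33n⌋}` — here
`B_k = numT(−k)/dhatT(−k) = ±C(2k−15n−2,17n)·C(k−6n−1,5n)·C(11n,k−15n−1)/((11n+1)·C(k−13n−1,11n+1))`. -/
theorem padicNorm_coefBT_zoneG_log (hn : 1 ≤ n) {k : ℤ} (h1 : 24 * (n : ℤ) + 2 ≤ k) (h2 : k ≤ 26 * (n : ℤ) + 1) :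
    padicNorm p (coefBT (aT n) (bT n) k) ≤ (p : ℚ) ^ (2 * Nat.log p (33 * n)) := by
  have hD3 : k ∈ Ico (aT n 3) (bT n 3) := by simp [mem_Ico]; omega
  have hnD2 : k ∉ Ico (aT n 2) (bT n 2) := by simp [mem_Ico]; omega
  have hm : multT (aT n) (bT n) k = 1 := (multT_partner k).2.2 h1 h2
  have eP0 : ∏ l ∈ Ico (bT n 0) (aT n 0), ((l : ℚ) - ((2 * k : ℤ) : ℚ))
      = (-1) ^ (aT n 0 - bT n 0).toNat * (((aT n 0 - bT n 0).toNat.factorial : ℕ) : ℚ)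
        * ((Nat.choose (2 * k - bT n 0).toNat (aT n 0 - bT n 0).toNat : ℕ) : ℚ) :=
    prod_Ico_sub_eq _ _ _ (by simp; omega) (by simp; omega)
  have eP1 : ∏ i ∈ Ico (bT n 1) (aT n 1), ((i : ℚ) - k)
      = (-1) ^ (aT n 1 - bT n 1).toNat * (((aT n 1 - bT n 1).toNat.factorial : ℕ) : ℚ)
        * ((Nat.choose (k - bT n 1).toNat (aT n 1 - bT n 1).toNat : ℕ) : ℚ) :=
    prod_Ico_sub_eq _ _ _ (by simp; omega) (by simp; omega)
  have eD : (dhatT (aT n) (bT n) k).eval (-(k : ℚ))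
      = ((-1) ^ (bT n 2 - aT n 2).toNat * (((bT n 2 - aT n 2).toNat.factorial : ℕ) : ℚ)
          * ((Nat.choose (k - aT n 2).toNat (bT n 2 - aT n 2).toNat : ℕ) : ℚ))
        * ((-1) ^ (k - aT n 3).toNat * (((k - aT n 3).toNat.factorial : ℕ) : ℚ)
          * (((bT n 3 - 1 - k).toNat.factorial : ℕ) : ℚ)) := by
    unfold dhatT
    rw [erase_eq_of_notMem hnD2, eval_mul, eval_prod, eval_prod]
    have e : ∀ (s : Finset ℤ), ∏ i ∈ s, ((X + C (i : ℚ)).eval (-(k : ℚ))) = ∏ i ∈ s, ((i : ℚ) - k) := fun s =>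
      prod_congr rfl fun i _ => by simp; ring
    rw [e, e, prod_Ico_sub_eq _ _ _ (by simp; omega) (by simp; omega), prod_erase_sub_eq hD3]
  rw [coefBT_of_simple hm, eval_numT_partner, eP0, eP1, eD]
  -- bookkeeping
  have e17 : (aT n 0 - bT n 0).toNat = 17 * n := by simp; omega
  have e5 : (aT n 1 - bT n 1).toNat = 5 * n := by simp; omega
  have e11 : (bT n 2 - aT n 2).toNat = 11 * n + 1 := by simp; omega
  have hC0 : (aT n 0 - bT n 0).toNat ≤ (2 * k - bT n 0).toNat := by simp; omega
  have hCk : (aT n 1 - bT n 1).toNat ≤ (k - bT n 1).toNat := by simp; omega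
  have hC2 : (bT n 2 - aT n 2).toNat ≤ (k - aT n 2).toNat := by simp; omega
  have ea3 : (k - aT n 3).toNat + (bT n 3 - 1 - k).toNat = 11 * n := by simp; omega
  have hK2 : (k - aT n 2).toNat ≤ 33 * n := by simp; omega
  obtain ⟨hN0, vN⟩ := padicValRat_normT_partner (p := p) n
  have hX0 := sign_fac_choose_ne_zero (aT n 0 - bT n 0).toNat (aT n 0 - bT n 0).toNat (2 * k - bT n 0).toNat hC0
  have vX0 := padicValRat_sign_fac_choose (p := p) (aT n 0 - bT n 0).toNat (aT n 0 - bT n 0).toNat (2 * k - bT n 0).toNat hC0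
  have hX1 := sign_fac_choose_ne_zero (aT n 1 - bT n 1).toNat (aT n 1 - bT n 1).toNat (k - bT n 1).toNat hCk
  have vX1 := padicValRat_sign_fac_choose (p := p) (aT n 1 - bT n 1).toNat (aT n 1 - bT n 1).toNat (k - bT n 1).toNat hCk
  have hY2 := sign_fac_choose_ne_zero (bT n 2 - aT n 2).toNat (bT n 2 - aT n 2).toNat (k - aT n 2).toNat hC2
  have vY2 := padicValRat_sign_fac_choose (p := p) (bT n 2 - aT n 2).toNat (bT n 2 - aT n 2).toNat (k - aT n 2).toNat hC2
  have hY3 := sign_fac_fac_ne_zero (k - aT n 3).toNat (k - aT n 3).toNat (bT n 3 - 1 - k).toNat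
  have vY3 := padicValRat_sign_fac_fac (p := p) (k - aT n 3).toNat (k - aT n 3).toNat (bT n 3 - 1 - k).toNat
  have r3 := padicValNat_factorial_add (p := p) (k - aT n 3).toNat (bT n 3 - 1 - k).toNat
  rw [ea3] at r3
  have r11 := padicValNat_factorial_succ (p := p) (11 * n)
  have kC : padicValNat p (Nat.choose (k - aT n 2).toNat (11 * n + 1)) ≤ Nat.log p (33 * n) :=
    (padicValNat_choose_le_log _ _).trans (Nat.log_mono_right hK2)
  have kN : padicValNat p (11 * n + 1) ≤ Nat.log p (33 * n) :=
    (padicValNat_le_nat_log _).trans (Nat.log_mono_right (by omega))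
  rw [e17] at vX0 hX0; rw [e5] at vX1 hX1; rw [e11] at vY2 hY2
  rw [e17, e5, e11]
  apply padicNorm_le_pow_of_val
  rw [padicValRat.div (mul_ne_zero (mul_ne_zero hN0 hX0) hX1) (mul_ne_zero hY2 hY3),
    padicValRat.mul (mul_ne_zero hN0 hX0) hX1, padicValRat.mul hN0 hX0, padicValRat.mul hY2 hY3,
    vN, vX0, vX1, vY2, vY3]
  omega

/-- **Zone β₂, every prime** (`16n+1 ≤ k ≤ 24n+1`): `‖B_k‖_p ≤ p^{⌊log_p 33n⌋}` — `B_k = A_k ×` the logarithmic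
derivative, a signed sum of reciprocals of nonzero integers of absolute value `≤ 33n`. -/
theorem padicNorm_coefBT_zoneB2_log (hn : 1 ≤ n) {k : ℤ} (h1 : 16 * (n : ℤ) + 1 ≤ k)
    (h2 : k ≤ 24 * (n : ℤ) + 1) :
    padicNorm p (coefBT (aT n) (bT n) k) ≤ (p : ℚ) ^ (Nat.log p (33 * n)) := by
  have hD2 : k ∈ Ico (aT n 2) (bT n 2) := by simp [mem_Ico]; omega
  have hD3 : k ∈ Ico (aT n 3) (bT n 3) := by simp [mem_Ico]; omega
  have hm : multT (aT n) (bT n) k = 2 := (multT_partner k).2.1 (by omega) h2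
  have hB0 : ∀ l ∈ Ico (bT n 0) (aT n 0), l ≠ 2 * k := fun l hl => by simp [mem_Ico] at hl; omega
  have hB1 : ∀ i ∈ Ico (bT n 1) (aT n 1), i ≠ k := fun i hi => by simp [mem_Ico] at hi; omega
  have hnum : (numT (aT n) (bT n)).eval (-(k : ℚ)) ≠ 0 := by
    rw [eval_numT_partner]
    refine mul_ne_zero (mul_ne_zero ?_ (prod_ne_zero_iff.2 fun l hl h => hB0 l hl ?_))
      (prod_ne_zero_iff.2 fun i hi h => hB1 i hi ?_)
    · unfold normT facZ; positivity
    · have : ((l : ℤ) : ℚ) = ((2 * k : ℤ) : ℚ) := by linarith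
      exact_mod_cast this
    · have : ((i : ℤ) : ℚ) = ((k : ℤ) : ℚ) := by linarith
      exact_mod_cast this
  have hden := eval_dhatT_ne_zero hD2 hD3
  have hA : padicNorm p (coefAT (aT n) (bT n) k) ≤ 1 := padicNorm_coefAT_le_one_all hn (by omega) h2
  rw [coefBT_of_double hm hnum hden, eval_derivative_numT_eq hB0 hB1, eval_derivative_dhatT_eq,
    mul_div_cancel_left₀ _ hnum, mul_div_cancel_left₀ _ hden, padicNorm.mul]
  have two_le : padicNorm p (2 : ℚ) ≤ 1 := by have := padicNorm.of_int (p := p) 2; simpa using this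
  have one_le : padicNorm p (1 : ℚ) ≤ 1 := by simp
  have hL : (0 : ℚ) ≤ (p : ℚ) ^ (Nat.log p (33 * n)) := by positivity
  have hS0 : padicNorm p (∑ l ∈ Ico (bT n 0) (aT n 0), 2 / ((l : ℚ) - 2 * k)) ≤ (p : ℚ) ^ (Nat.log p (33 * n)) := by
    refine padicNorm.sum_le' (fun l hl => ?_) hL
    simp only [mem_Ico, aT_zero, bT_zero] at hl
    have e : (l : ℚ) - 2 * k = ((l - 2 * k : ℤ) : ℚ) := by push_cast; ring
    rw [e]; exact padicNorm_div_int_le_log two_le (by omega) (by omega)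
  have hS1 : padicNorm p (∑ i ∈ Ico (bT n 1) (aT n 1), 1 / ((i : ℚ) - k)) ≤ (p : ℚ) ^ (Nat.log p (33 * n)) := by
    refine padicNorm.sum_le' (fun i hi => ?_) hL
    simp only [mem_Ico, aT_one, bT_one] at hi
    have e : (i : ℚ) - k = ((i - k : ℤ) : ℚ) := by push_cast; ring
    rw [e]; exact padicNorm_div_int_le_log one_le (by omega) (by omega)
  have hS2 : padicNorm p (∑ i ∈ (Ico (aT n 2) (bT n 2)).erase k, 1 / ((i : ℚ) - k))
      ≤ (p : ℚ) ^ (Nat.log p (33 * n)) := by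
    refine padicNorm.sum_le' (fun i hi => ?_) hL
    have hik := ne_of_mem_erase hi; have hi' := mem_of_mem_erase hi
    simp only [mem_Ico, aT_two, bT_two] at hi'
    have e : (i : ℚ) - k = ((i - k : ℤ) : ℚ) := by push_cast; ring
    rw [e]; exact padicNorm_div_int_le_log one_le (by omega) (by omega)
  have hS3 : padicNorm p (∑ i ∈ (Ico (aT n 3) (bT n 3)).erase k, 1 / ((i : ℚ) - k))
      ≤ (p : ℚ) ^ (Nat.log p (33 * n)) := by
    refine padicNorm.sum_le' (fun i hi => ?_) hL
    have hik := ne_of_mem_erase hi; have hi' := mem_of_mem_erase hi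
    simp only [mem_Ico, aT_three, bT_three] at hi'
    have e : (i : ℚ) - k = ((i - k : ℤ) : ℚ) := by push_cast; ring
    rw [e]; exact padicNorm_div_int_le_log one_le (by omega) (by omega)
  have hsum : padicNorm p (∑ l ∈ Ico (bT n 0) (aT n 0), 2 / ((l : ℚ) - 2 * k)
      + ∑ i ∈ Ico (bT n 1) (aT n 1), 1 / ((i : ℚ) - k)
      - (∑ i ∈ (Ico (aT n 2) (bT n 2)).erase k, 1 / ((i : ℚ) - k)
        + ∑ i ∈ (Ico (aT n 3) (bT n 3)).erase k, 1 / ((i : ℚ) - k))) ≤ (p : ℚ) ^ (Nat.log p (33 * n)) :=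
    (padicNorm.sub).trans (max_le ((padicNorm.nonarchimedean).trans (max_le hS0 hS1))
      ((padicNorm.nonarchimedean).trans (max_le hS2 hS3)))
  calc padicNorm p (coefAT (aT n) (bT n) k) * _ ≤ 1 * (p : ℚ) ^ (Nat.log p (33 * n)) :=
        mul_le_mul hA hsum (padicNorm.nonneg _) zero_le_one
    _ = _ := one_mul _

/-- **`‖B_k‖_p ≤ p^{2⌊log_p 33n⌋}` on the whole range `13n+1 ≤ k ≤ 26n+1`, every prime.** -/
theorem padicNorm_coefBT_le_log (hn : 1 ≤ n) {k : ℤ} (h1 : 13 * (n : ℤ) + 1 ≤ k) (h2 : k ≤ 26 * (n : ℤ) + 1) :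
    padicNorm p (coefBT (aT n) (bT n) k) ≤ (p : ℚ) ^ (2 * Nat.log p (33 * n)) := by
  have hp1 : (1 : ℚ) ≤ p := by exact_mod_cast hp.out.one_lt.le
  rcases le_or_gt k (15 * (n : ℤ)) with hk | hk
  · rw [coefBT_zoneA h1 hk, padicNorm.zero]; positivity
  rcases le_or_gt k (16 * (n : ℤ)) with hk' | hk'
  · exact padicNorm_coefBT_zoneB1_log hn (by omega) hk'
  rcases le_or_gt k (24 * (n : ℤ) + 1) with hk'' | hk''
  · exact (padicNorm_coefBT_zoneB2_log hn (by omega) hk'').trans (pow_le_pow_right₀ hp1 (by omega))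
  · exact padicNorm_coefBT_zoneG_log hn (by omega) h2

end Zones

/-! ### Assembly -/

section Assembly

variable {n : ℕ} {p : ℕ} [hp : Fact p.Prime]

/-- **Crude Lemma 8 for `p̂` at EVERY prime**: `‖p̂_n‖_p ≤ p^{3⌊log_p 33n⌋}` (`n ≥ 1`). -/
theorem padicNorm_formPT_le_log (hn : 1 ≤ n) :
    padicNorm p (formPT (aT n) (bT n)) ≤ (p : ℚ) ^ (3 * Nat.log p (33 * n)) := by
  have hp1 : (1 : ℚ) ≤ p := by exact_mod_cast hp.out.one_lt.le
  obtain ⟨hA3, hB2⟩ := range_eq n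
  obtain ⟨hMid, hMax, h0s⟩ := rangeB_eq n
  have hsign : padicNorm p (signT (bT n)) = 1 := by
    unfold signT; rcases neg_one_pow_eq_or ℚ (bT n 2 + bT n 3).natAbs with h | h <;> rw [h] <;> simp
  unfold formPT
  rw [padicNorm.mul, hsign, one_mul, hA3, hB2, hMid, hMax, h0s]
  have two_le : padicNorm p (2 : ℚ) ≤ 1 := by have := padicNorm.of_int (p := p) 2; simpa using this
  have hL : (0 : ℚ) ≤ (p : ℚ) ^ (3 * Nat.log p (33 * n)) := by positivity
  have hA : ∀ k ∈ Ico (15 * (n : ℤ) + 1) (24 * (n : ℤ) + 2),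
      padicNorm p (2 * coefAT (aT n) (bT n) k * harmAlt2 (2 * k - (26 * (n : ℤ) + 2)).toNat)
        ≤ (p : ℚ) ^ (3 * Nat.log p (33 * n)) := by
    intro k hk
    rw [mem_Ico] at hk
    rw [padicNorm.mul, padicNorm.mul]
    have hH := padicNorm_harmAlt2_le_log (p := p) (m := (2 * k - (26 * (n : ℤ) + 2)).toNat) (M := 33 * n)
      (by omega)
    have hAk := padicNorm_coefAT_le_one_all (p := p) hn hk.1 (by omega)
    calc padicNorm p 2 * padicNorm p (coefAT (aT n) (bT n) k)
          * padicNorm p (harmAlt2 (2 * k - (26 * (n : ℤ) + 2)).toNat)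
        ≤ 1 * 1 * (p : ℚ) ^ (2 * Nat.log p (33 * n)) :=
          mul_le_mul (mul_le_mul two_le hAk (padicNorm.nonneg _) zero_le_one) hH (padicNorm.nonneg _)
            (by positivity)
      _ ≤ (p : ℚ) ^ (3 * Nat.log p (33 * n)) := by
          rw [one_mul, one_mul]; exact pow_le_pow_right₀ hp1 (by omega)
  have hB : ∀ k ∈ Ico (13 * (n : ℤ) + 1) (26 * (n : ℤ) + 2),
      padicNorm p (coefBT (aT n) (bT n) k * harmAlt1 (2 * k - (26 * (n : ℤ) + 2)).toNat)
        ≤ (p : ℚ) ^ (3 * Nat.log p (33 * n)) := by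
    intro k hk
    rw [mem_Ico] at hk
    rw [padicNorm.mul]
    have hH := padicNorm_harmAlt1_le_log (p := p) (m := (2 * k - (26 * (n : ℤ) + 2)).toNat) (M := 33 * n)
      (by omega)
    have hBk := padicNorm_coefBT_le_log (p := p) hn hk.1 (by omega)
    calc padicNorm p (coefBT (aT n) (bT n) k) * padicNorm p (harmAlt1 (2 * k - (26 * (n : ℤ) + 2)).toNat)
        ≤ (p : ℚ) ^ (2 * Nat.log p (33 * n)) * (p : ℚ) ^ (Nat.log p (33 * n)) :=
          mul_le_mul hBk hH (padicNorm.nonneg _) (by positivity)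
      _ = (p : ℚ) ^ (3 * Nat.log p (33 * n)) := by rw [← pow_add]; congr 1; ring
  exact (padicNorm.nonarchimedean).trans (max_le (padicNorm.sum_le' hA hL) (padicNorm.sum_le' hB hL))

/-- Valuation form: for every prime `p` and `n ≥ 1`, `p^{3⌊log_p 33n⌋} · p̂_n` is `p`-integral. -/
theorem padicNorm_pow_mul_formPT_le_one (hn : 1 ≤ n) :
    padicNorm p (((p : ℚ) ^ (3 * Nat.log p (33 * n))) * formPT (aT n) (bT n)) ≤ 1 := by
  have hp0 : (p : ℚ) ≠ 0 := by exact_mod_cast hp.out.ne_zero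
  have hpow : padicNorm p ((p : ℚ) ^ (3 * Nat.log p (33 * n))) = ((p : ℚ) ^ (3 * Nat.log p (33 * n)))⁻¹ := by
    rw [padicNorm.eq_zpow_of_nonzero (pow_ne_zero _ hp0), padicValRat.pow, padicValRat.self hp.out.one_lt,
      mul_one, zpow_neg, zpow_natCast]
  rw [padicNorm.mul, hpow, inv_mul_le_iff₀ (by positivity), mul_one]
  exact padicNorm_formPT_le_log hn

end Assembly

end Summit.KontsevichZagierPeriods.Zeta5Search.TwoTaleP15

end
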